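import Literature.AlgebraicGeometry.Motives.HodgeStructureExteriorPowerTensorPower
import Literature.AlgebraicGeometry.Motives.HodgeStructureAbelianTypePolarizable
import Literature.AlgebraicGeometry.Motives.WeilTypeCM
import Literature.AlgebraicGeometry.Motives.ZarhinHodgeGroupLieAlgebra
import HarnessLib

/-!
# The Lie algebra of the Hodge group kills the Hodge classes of `⋀ᵏ H`: `D_X w = 0` for `X ∈ 𝔥(H)`, `w ∈ Hdgᵖ(⋀ᵏ H)`
# (Deligne 1982 I §3.1, Prop. 3.4: `Hg` fixes the Hodge classes of every tensor construction — infinitesimally, on exterior powers)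

Family `hodge`, layer `Literature/AlgebraicGeometry/Motives`; THEOREMS ONLY (no definition, no named fact).  Written for the cell
`pub-hodgecm2` (COR-CM), seat `b27` gen 48 (count-neutral Mumford–Tate-rank ladder: Weil classes on `E × T` obstruct the product
decomposition `Hg(E × T) = Hg(E) × Hg(T)`, Moonen–Zarhin 1999 Thm. 0.1 (4)(a)).

The tree's Hodge Lie algebra `𝔥(H) = H.hodgeLie` is the annihilator of the Hodge classes of the tensor spaces
`T^{a,b} H = H^{⊗a} ⊗ (H^∨)^{⊗b}` under the derivation action `tensorDerivation a b` (`Motives/ZarhinHodgeGroupLieAlgebra`,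
`mem_hodgeLie_iff`).  The exterior power `⋀ᵏ H = H.exteriorPower k` (`Motives/HodgeStructureExteriorPowerGeneralWeight`) is a retract of
`H^{⊗k}` by the morphisms `η = Hom.wedgeToTensor` (normalised antisymmetrisation) and `π = Hom.tensorToWedge` (wedge projection,
`π ∘ η = id`, `Motives/HodgeStructureExteriorPowerTensorPower`), and `H^{⊗k} ≅ T^{k,0} H` by `x ↦ x ⊗ ⊗()`
(`Hom.toTensorSpaceZero`, `Motives/HodgeStructureAbelianTypePolarizable`).  The derivation `D_X` of `X ∈ End_ℚ(V)` on `⋀ᵏ V` is the tree's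
`derivationExteriorPower X k` (`Motives/WeilTypeCM`: `D_X (v₁ ∧ ⋯ ∧ v_k) = Σᵢ v₁ ∧ ⋯ ∧ X vᵢ ∧ ⋯ ∧ v_k`).

RESULTS.
* `tensorToWedge_piTensorDerivation` — NATURALITY of the wedge projection for derivations: `π (D^⊗_X y) = D^∧_X (π y)`
  (both are `Σᵢ v₁ ∧ ⋯ ∧ X vᵢ ∧ ⋯ ∧ v_k` on pure tensors).
* `tensorDerivation_toTensorSpaceZero` — `ρ_{k,0}(X) (y ⊗ ⊗()) = (D^⊗_X y) ⊗ ⊗()` (no contravariant slots).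
* `piTensorDerivation_apply_eq_zero_of_mem_hodgeLie` — `X ∈ 𝔥(H)` kills the Hodge classes of `H^{⊗k}` (`p + p = k n`).
* **`derivationExteriorPower_apply_eq_zero_of_mem_hodgeLie`** — `X ∈ 𝔥(H)`, `w ∈ Hdgᵖ(⋀ᵏ H)`, `p + p = k n` ⟹ `D^∧_X w = 0`
  (`η w` is a Hodge class of `H^{⊗k}`, hence killed by `D^⊗_X`; apply `π`).  Contrapositive
  **`not_mem_hodgeLie_of_derivationExteriorPower_apply_ne_zero`**: a rational operator moving a Hodge class of `⋀ᵏ H` is not in `𝔥(H)` —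
  the infinitesimal form of «exceptional Hodge classes cut down the Hodge group».

## References
* [Deligne1982HodgeCycles] P. Deligne, *Hodge cycles on abelian varieties*, LNM 900 (1982), I §3.1 (the tensor constructions and the induced
  actions) and Prop. 3.4 (`Hg` is the stabiliser of the Hodge classes). [cite: Deligne1982HodgeCycles, I §3.1 and Prop. 3.4]
* [Greub1978Multilinear] W. Greub, *Multilinear Algebra* (2nd ed. 1978), §5.3 (`π ∘ η = ι`). [cite: Greub1978Multilinear, §5.3]
* [MoonenZarhin1999LowDim] B. Moonen, Yu. G. Zarhin, Math. Ann. 315 (1999), §3 (3.1) (exceptional classes on `X₁^m × X₂^n` iff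
  `Hg(X₁ × X₂) ≠ Hg(X₁) × Hg(X₂)`). [cite: MoonenZarhin1999LowDim, §3 (3.1)]
-/

noncomputable section

open scoped TensorProduct

namespace Literature.AlgebraicGeometry.Motives

namespace HodgeStructure

universe u

variable {V : Type u} [AddCommGroup V] [Module ℚ V]

/-! ## §1 Naturality of the wedge projection and of `x ↦ x ⊗ ⊗()` for derivations -/

/-- **`π (D^⊗_X y) = D^∧_X (π y)`**: the wedge projection `π : V^{⊗k} → ⋀ᵏ V` intertwines the derivation of `X` on the tensor power
(`piTensorDerivation k X`) with its derivation on the exterior power (`derivationExteriorPower X k`) — on a pure tensor both sides are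
`Σᵢ v₁ ∧ ⋯ ∧ X vᵢ ∧ ⋯ ∧ v_k`. [cite: Greub1978Multilinear, §5.3] [cite: Deligne1982HodgeCycles, I §3.1 and Prop. 3.4] -/
theorem tensorToWedge_piTensorDerivation (k : ℕ) (X : Module.End ℚ V) (y : ⨂[ℚ]^k V) :
    tensorToWedge ℚ V k (piTensorDerivation k X y) = derivationExteriorPower X k (tensorToWedge ℚ V k y) := by
  induction y using PiTensorProduct.induction_on with
  | smul_tprod c v =>
    rw [map_smul, map_smul, map_smul, map_smul, piTensorDerivation_tprod, map_sum, tensorToWedge_tprod,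
      derivationExteriorPower_ιMulti]
    simp only [tensorToWedge_tprod]
  | add x y hx hy => rw [map_add, map_add, map_add, map_add, hx, hy]

/-- **`ρ_{k,0}(X) (y ⊗ ⊗()) = (D^⊗_X y) ⊗ ⊗()`**: on `T^{k,0} V = V^{⊗k} ⊗ (V^∨)^{⊗0}` the derivation action has no contravariant term
(the sum over the `0` dual slots is empty). [cite: Deligne1982HodgeCycles, I §3.1] -/
theorem tensorDerivation_toTensorSpaceZero (k : ℕ) (X : Module.End ℚ V) (y : ⨂[ℚ]^k V) :
    tensorDerivation k 0 X (toTensorSpaceZero V k y) = toTensorSpaceZero V k (piTensorDerivation k X y) := by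
  rw [toTensorSpaceZero_apply, toTensorSpaceZero_apply, tensorDerivation_apply, LinearMap.sub_apply, LinearMap.rTensor_tmul,
    LinearMap.lTensor_tmul, piTensorDerivation_tprod, Finset.univ_eq_empty, Finset.sum_empty, TensorProduct.tmul_zero, sub_zero]

/-! ## §2 `𝔥(H)` kills the Hodge classes of `H^{⊗k}` and of `⋀ᵏ H` -/

variable [Module.Finite ℚ V] [HodgeTensorFacts.{u, u}] {n : ℤ} (H : HodgeStructure V n)

omit [Module.Finite ℚ V] [HodgeTensorFacts.{u, u}] in
/-- A morphism of Hodge structures maps Hodge classes to Hodge classes (`φ_ℂ (1 ⊗ v) = 1 ⊗ φ v`, `φ_ℂ Fᵖ ⊆ Fᵖ`); local copy of the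
tree's `Hom.apply_mem_hodgeClasses`. [folklore] -/
private theorem hom_apply_mem_hodgeClasses' {W : Type u} [AddCommGroup W] [Module ℚ W] {m : ℤ} {H₁ : HodgeStructure V m}
    {H₂ : HodgeStructure W m} (φ : Hom H₁ H₂) {p : ℤ} {v : V} (hv : v ∈ H₁.hodgeClasses p) :
    φ.toLinearMap v ∈ H₂.hodgeClasses p := by
  rw [mem_hodgeClasses_iff] at hv ⊢
  have h : φ.toLinearMap.baseChange ℂ (ofRat v) = ofRat (φ.toLinearMap v) := by
    rw [ofRat_apply, ofRat_apply, LinearMap.baseChange_tmul]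
  rw [← h]
  exact φ.map_F_le p ⟨_, hv, rfl⟩

/-- **`X ∈ 𝔥(H)` kills the Hodge classes of the tensor power `H^{⊗k}`**: for `y ∈ Hdgᵖ(H^{⊗k})` with `p + p = k n`,
`D^⊗_X y = 0` — transport `y ↦ y ⊗ ⊗()` to the tensor space `T^{k,0} H` (a morphism of Hodge structures, `Hom.toTensorSpaceZero`), where
`𝔥(H)` kills the Hodge classes by definition (`mem_hodgeLie_iff`), and use the injectivity of `y ↦ y ⊗ ⊗()`.
[cite: Deligne1982HodgeCycles, I §3.1 and Prop. 3.4] -/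
theorem piTensorDerivation_apply_eq_zero_of_mem_hodgeLie {X : Module.End ℚ V} (hX : X ∈ H.hodgeLie) {k : ℕ} {p : ℤ}
    (hp : p + p = (k : ℤ) * n) {y : ⨂[ℚ]^k V} (hy : y ∈ (H.tensorPower k).hodgeClasses p) :
    piTensorDerivation k X y = 0 := by
  have hy' : toTensorSpaceZero V k y ∈ (H.tensorSpace k 0).hodgeClasses p := by
    have h := hom_apply_mem_hodgeClasses' (Hom.toTensorSpaceZero H k) hy
    rwa [cast_hodgeClasses] at h
  have hab : (((k : ℕ) : ℤ) - ((0 : ℕ) : ℤ)) * n = 2 * p := by rw [Nat.cast_zero, sub_zero, ← hp, two_mul]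
  have h0 := (mem_hodgeLie_iff H X).1 hX k 0 p hab _ hy'
  rw [tensorDerivation_toTensorSpaceZero, ← map_zero (toTensorSpaceZero V k)] at h0
  exact toTensorSpaceZero_injective k h0

/-- **`X ∈ 𝔥(H)` kills the Hodge classes of `⋀ᵏ H`: `D^∧_X w = 0` for `w ∈ Hdgᵖ(⋀ᵏ H)`, `p + p = k n`.**  The antisymmetrisation
`η w ∈ H^{⊗k}` is a Hodge class (morphism of Hodge structures `Hom.wedgeToTensor`), so `D^⊗_X (η w) = 0`; apply the wedge projection:
`D^∧_X w = D^∧_X (π η w) = π (D^⊗_X (η w)) = 0`.  Infinitesimal form of Deligne's «`Hg` fixes every Hodge class of every tensor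
construction» for `⋀ᵏ`. [cite: Deligne1982HodgeCycles, I §3.1 and Prop. 3.4] [cite: Greub1978Multilinear, §5.3] -/
theorem derivationExteriorPower_apply_eq_zero_of_mem_hodgeLie {X : Module.End ℚ V} (hX : X ∈ H.hodgeLie) {k : ℕ} {p : ℤ}
    (hp : p + p = (k : ℤ) * n) {w : ⋀[ℚ]^k V} (hw : w ∈ (H.exteriorPower k).hodgeClasses p) :
    derivationExteriorPower X k w = 0 := by
  have hη : wedgeToTensor V k w ∈ (H.tensorPower k).hodgeClasses p := hom_apply_mem_hodgeClasses' (Hom.wedgeToTensor H k) hw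
  have h0 := piTensorDerivation_apply_eq_zero_of_mem_hodgeLie H hX hp hη
  have h := congrArg (tensorToWedge ℚ V k) h0
  rwa [map_zero, tensorToWedge_piTensorDerivation, tensorToWedge_wedgeToTensor] at h

/-- **A rational operator that moves a Hodge class of `⋀ᵏ H` is not in `𝔥(H)`** (contrapositive): «exceptional Hodge classes cut down the
Hodge group», infinitesimally. [cite: Deligne1982HodgeCycles, I §3.1 and Prop. 3.4] [cite: MoonenZarhin1999LowDim, §3 (3.1)] -/
theorem not_mem_hodgeLie_of_derivationExteriorPower_apply_ne_zero {X : Module.End ℚ V} {k : ℕ} {p : ℤ} (hp : p + p = (k : ℤ) * n)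
    {w : ⋀[ℚ]^k V} (hw : w ∈ (H.exteriorPower k).hodgeClasses p) (hXw : derivationExteriorPower X k w ≠ 0) :
    X ∉ H.hodgeLie := fun hX =>
  hXw (derivationExteriorPower_apply_eq_zero_of_mem_hodgeLie H hX hp hw)

end HodgeStructure

end Literature.AlgebraicGeometry.Motives

end
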